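import Summits.AtomisticToContinuum.HydrodynamicLimit.Theorems.RelayRaceLocalityConeLocalisationInitialFloor
import HarnessLib

/-!
# Crux `ConeLocalisation` (stmt-AtomisticToContinuum-12504) — line `Sketch` (card `zoomed-bubble-transplant`), skeleton v6 (lead c5, 2026-08-17; = v4/v5 of lead c4 with stub 1 DISCHARGED by the landed theorem p140969)

Route `RelayRaceLocality`; crux decl `Summit.AtomisticToContinuum.HydrodynamicLimit.Theses.RelayRaceLocality.ConeLocalisation`
`= LightConeInLaw → NearConstantShortTimeHL → S` (`S` = short-time guarded hydrodynamic limit, NO density floor).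

STATE. The line is COMPLETE for the floored crux: all seven registered stubs of skeleton v2 (lead 0) are tree theorems
and their composition is `Theorems.ConeLocalisation.coneLocalisationFloored_holds : ConeLocalisationFloored =
LightConeInLaw → NearConstantShortTimeHL → S♭` (p137065), `S♭` = `S` with the guard `M⁻¹ ≤ ρ s x` on the whole slab
`[0, t]`. Skeleton v3 (lead c3) had the single stub `stub_floorRemoval : A → B → S♭ → S` (= the item, p139719).

THIS v4 (lead c4) sharpens the residual to ONE INITIAL-DATUM HYPOTHESIS. Write `S₀` := `S` as typed with the single
extra hypothesis `(∀ x, M⁻¹ ≤ ρ 0 x)` (a floor on the INITIAL density only) inserted before `∀ t ∈ Ico 0 (min T τ₁)`.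

* `stub_initiallyFloored : A → B → S₀` — PROVABLE and proved by this seat (`Theorems/…ConeLocalisationInitialFloor.lean`:
  density drift `|ρ(t,x) − ρ(0,x)| ≤ 6 M² t` from the mass equation alone, so an initial floor `M⁻¹` survives as
  `(2M)⁻¹` up to time `1/(12 M³)` under the level-`M` guards, and `S♭` at level `2M` applies);
* `stub_initialFloorRemoval : A → B → S₀ → S` — the RESIDUAL: removal of the initial floor. For the conjunct's family
  the initial density is pinned by `(a₀, θ₀, σ)` (LLN at `t = 0`), quantified AFTER `τ₁`; admissible data with
  arbitrarily deep density troughs (all absolute derivatives `≤ M`) keep every level-`M` guard alive on `[0, t]` and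
  are coverable by no `NearConstantShortTimeHL`-licensed comparison gas through `LightConeInLaw`'s exact-agreement
  ball (Disproof.lean §3, `Theorems/ConeLocalisation/Negative/{TroughFamily,FloorRemovalSchema}` p132963/p133018);
  `HydrodynamicLimit → S` (p132898), so the residual is neither provable from the antecedents nor refutable below
  summit level. It is where the line dies (`Lines/Sketch.dead.md`).

Composition: `coneLocalisation_of : ConeLocalisation := fun hA hB => stub_initialFloorRemoval hA hB (stub_initiallyFloored hA hB)`.
See `Cruxes/ConeLocalisation/PICKED.md`, `Cruxes/ConeLocalisation/NOTES.md`.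
-/

noncomputable section

open Literature.MathematicalPhysics.KineticTheory Literature.Analysis.FluidPDE
open Literature.Analysis.FunctionSpaces MeasureTheory Filter Set Topology
open Summit.AtomisticToContinuum.HydrodynamicLimit.Theses.RelayRaceLocality
open Summit.AtomisticToContinuum.HydrodynamicLimit.Theorems.ConeLocalisation

namespace Summit.AtomisticToContinuum.HydrodynamicLimit.Cruxes.ConeLocalisation.ZoomedBubble

/-! ## Landed (skeleton v2, all seven stubs): `coneLocalisationFloored_holds : ConeLocalisationFloored` (p137065) -/

/-! ## Stub 1 (provable; this seat): the crux with a floor on the INITIAL density only -/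

/-- STUB 1 (CLOSED — lead c4 proved it, p140969, `Theorems/RelayRaceLocalityConeLocalisationInitialFloor.lean`; discharged here by name): `A → B → S₀` — the two
antecedents deliver the short-time guarded hydrodynamic limit for every datum whose INITIAL density is `≥ M⁻¹`
(drift bound from the mass equation + the landed floored crux at level `2M`). -/
theorem stub_initiallyFloored :
    LightConeInLaw → NearConstantShortTimeHL →
      (∃ η₀ : ℝ, 0 < η₀ ∧ ∀ M : ℝ, 0 < M → ∃ τ₁ : ℝ, 0 < τ₁ ∧ ∀ (a₀ θ₀ : T3 → ℝ) (u₀ : T3 → V3), Continuous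
      a₀ → Continuous θ₀ → Continuous u₀ → (∀ x, 0 < a₀ x) → (∀ x, 0 < θ₀ x) → ∃ σ₀ : ℝ, 0 < σ₀ ∧ ∀ σ : ℝ, 0
      < σ → σ < σ₀ → ∀ (T : ℝ) (ρ θ : ℝ → T3 → ℝ) (u : ℝ → T3 → V3), IsHardSphereEulerSolution σ T ρ u θ → ∀
      Φ : (N : ℕ) → HardSphereFlow (Torus.geometry (Fin 3)) (hsDiameter σ N) (N + 1), TendstoHydroFieldsAt
      (fun N => localGibbsLaw σ a₀ u₀ θ₀ N (Φ N)) Φ ρ u θ 0 → (∀ x, M⁻¹ ≤ ρ 0 x) →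
      ∀ t ∈ Set.Ico 0 (min T τ₁), (∀ s ∈ Set.Icc 0
      t, ∀ x, ρ s x * σ ^ 3 < η₀ ∧ ρ s x ≤ M ∧ θ s x ≤ M ∧ M⁻¹ ≤ θ s x ∧ ‖u s x‖ ≤ M ∧ ∀ i j k : Fin 3,
      |Torus.partialDeriv i (ρ s) x| ≤ M ∧ ‖Torus.partialDeriv i (u s) x‖ ≤ M ∧ |Torus.partialDeriv i (θ s)
      x| ≤ M ∧ |Torus.partialDeriv i (Torus.partialDeriv j (ρ s)) x| ≤ M ∧ ‖Torus.partialDeriv i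
      (Torus.partialDeriv j (u s)) x‖ ≤ M ∧ |Torus.partialDeriv i (Torus.partialDeriv j (θ s)) x| ≤ M ∧
      |Torus.partialDeriv i (Torus.partialDeriv j (Torus.partialDeriv k (ρ s))) x| ≤ M ∧ ‖Torus.partialDeriv
      i (Torus.partialDeriv j (Torus.partialDeriv k (u s))) x‖ ≤ M ∧ |Torus.partialDeriv i
      (Torus.partialDeriv j (Torus.partialDeriv k (θ s))) x| ≤ M) → TendstoHydroFieldsAt (fun N =>
      localGibbsLaw σ a₀ u₀ θ₀ N (Φ N)) Φ ρ u θ t) :=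
  -- LANDED (p140969): `Theorems/RelayRaceLocalityConeLocalisationInitialFloor.lean`
  Summit.AtomisticToContinuum.HydrodynamicLimit.Theorems.ConeLocalisation.stub_initiallyFloored

/-! ## Stub 2 (the residual; where the line dies): removal of the initial floor -/

/-- STUB (transfer; the residual of the typed crux): `A → B → S₀ → S` — removal of the single initial-datum
hypothesis `∀ x, M⁻¹ ≤ ρ 0 x`. Unreachable from the antecedents (deep-trough data) and unrefutable below summit
level (`HydrodynamicLimit → S`). -/
theorem stub_initialFloorRemoval :
    LightConeInLaw → NearConstantShortTimeHL →
      (∃ η₀ : ℝ, 0 < η₀ ∧ ∀ M : ℝ, 0 < M → ∃ τ₁ : ℝ, 0 < τ₁ ∧ ∀ (a₀ θ₀ : T3 → ℝ) (u₀ : T3 → V3), Continuous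
      a₀ → Continuous θ₀ → Continuous u₀ → (∀ x, 0 < a₀ x) → (∀ x, 0 < θ₀ x) → ∃ σ₀ : ℝ, 0 < σ₀ ∧ ∀ σ : ℝ, 0
      < σ → σ < σ₀ → ∀ (T : ℝ) (ρ θ : ℝ → T3 → ℝ) (u : ℝ → T3 → V3), IsHardSphereEulerSolution σ T ρ u θ → ∀
      Φ : (N : ℕ) → HardSphereFlow (Torus.geometry (Fin 3)) (hsDiameter σ N) (N + 1), TendstoHydroFieldsAt
      (fun N => localGibbsLaw σ a₀ u₀ θ₀ N (Φ N)) Φ ρ u θ 0 → (∀ x, M⁻¹ ≤ ρ 0 x) →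
      ∀ t ∈ Set.Ico 0 (min T τ₁), (∀ s ∈ Set.Icc 0
      t, ∀ x, ρ s x * σ ^ 3 < η₀ ∧ ρ s x ≤ M ∧ θ s x ≤ M ∧ M⁻¹ ≤ θ s x ∧ ‖u s x‖ ≤ M ∧ ∀ i j k : Fin 3,
      |Torus.partialDeriv i (ρ s) x| ≤ M ∧ ‖Torus.partialDeriv i (u s) x‖ ≤ M ∧ |Torus.partialDeriv i (θ s)
      x| ≤ M ∧ |Torus.partialDeriv i (Torus.partialDeriv j (ρ s)) x| ≤ M ∧ ‖Torus.partialDeriv i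
      (Torus.partialDeriv j (u s)) x‖ ≤ M ∧ |Torus.partialDeriv i (Torus.partialDeriv j (θ s)) x| ≤ M ∧
      |Torus.partialDeriv i (Torus.partialDeriv j (Torus.partialDeriv k (ρ s))) x| ≤ M ∧ ‖Torus.partialDeriv
      i (Torus.partialDeriv j (Torus.partialDeriv k (u s))) x‖ ≤ M ∧ |Torus.partialDeriv i
      (Torus.partialDeriv j (Torus.partialDeriv k (θ s))) x| ≤ M) → TendstoHydroFieldsAt (fun N =>
      localGibbsLaw σ a₀ u₀ θ₀ N (Φ N)) Φ ρ u θ t) →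
      (∃ η₀ : ℝ, 0 < η₀ ∧ ∀ M : ℝ, 0 < M → ∃ τ₁ : ℝ, 0 < τ₁ ∧ ∀ (a₀ θ₀ : T3 → ℝ) (u₀ : T3 → V3), Continuous
      a₀ → Continuous θ₀ → Continuous u₀ → (∀ x, 0 < a₀ x) → (∀ x, 0 < θ₀ x) → ∃ σ₀ : ℝ, 0 < σ₀ ∧ ∀ σ : ℝ, 0
      < σ → σ < σ₀ → ∀ (T : ℝ) (ρ θ : ℝ → T3 → ℝ) (u : ℝ → T3 → V3), IsHardSphereEulerSolution σ T ρ u θ → ∀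
      Φ : (N : ℕ) → HardSphereFlow (Torus.geometry (Fin 3)) (hsDiameter σ N) (N + 1), TendstoHydroFieldsAt
      (fun N => localGibbsLaw σ a₀ u₀ θ₀ N (Φ N)) Φ ρ u θ 0 → ∀ t ∈ Set.Ico 0 (min T τ₁), (∀ s ∈ Set.Icc 0
      t, ∀ x, ρ s x * σ ^ 3 < η₀ ∧ ρ s x ≤ M ∧ θ s x ≤ M ∧ M⁻¹ ≤ θ s x ∧ ‖u s x‖ ≤ M ∧ ∀ i j k : Fin 3,
      |Torus.partialDeriv i (ρ s) x| ≤ M ∧ ‖Torus.partialDeriv i (u s) x‖ ≤ M ∧ |Torus.partialDeriv i (θ s)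
      x| ≤ M ∧ |Torus.partialDeriv i (Torus.partialDeriv j (ρ s)) x| ≤ M ∧ ‖Torus.partialDeriv i
      (Torus.partialDeriv j (u s)) x‖ ≤ M ∧ |Torus.partialDeriv i (Torus.partialDeriv j (θ s)) x| ≤ M ∧
      |Torus.partialDeriv i (Torus.partialDeriv j (Torus.partialDeriv k (ρ s))) x| ≤ M ∧ ‖Torus.partialDeriv
      i (Torus.partialDeriv j (Torus.partialDeriv k (u s))) x‖ ≤ M ∧ |Torus.partialDeriv i
      (Torus.partialDeriv j (Torus.partialDeriv k (θ s))) x| ≤ M) → TendstoHydroFieldsAt (fun N =>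
      localGibbsLaw σ a₀ u₀ θ₀ N (Φ N)) Φ ρ u θ t) := by
  sorry

/-! ## The composition -/

/-- COMPOSITION: the crux `ConeLocalisation` BY NAME from the two stubs. -/
theorem coneLocalisation_of : ConeLocalisation :=
  fun hA hB => stub_initialFloorRemoval hA hB (stub_initiallyFloored hA hB)

end Summit.AtomisticToContinuum.HydrodynamicLimit.Cruxes.ConeLocalisation.ZoomedBubble

end
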